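import Literature.Analysis.FluidPDE.KwonTestField
import Literature.Analysis.FluidPDE.DecayingScalarIntegrationByParts
import Literature.Analysis.FluidPDE.DifferentiableGaussGreen
import Literature.Analysis.FluidPDE.DivFreeVectorPotential
import HarnessLib

/-!
# Kwon's slice duality identity `∫ ⟪u, ζ⟫ = ∫ ⟪u − h, ξ⟫` (localized Leray projection by duality)

Analysis/FluidPDE file on the discharge path of the named fact
`Literature.Analysis.FluidPDE.kwon2023_velocity_epsilon_regularity`
(`PressureFreeEpsilonRegularity.lean`; H. Kwon, J. Differential Equations (2023) =
arXiv:2104.03160, Thm. 1.4), third brick of Lemma 2.5 after `KwonHarmonicPart.lean` (the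
harmonic part `h = −𝔾(u·∇φ) + curl 𝕂(∇φ × u)` of a slice `u ∈ L¹(B₂)`) and `KwonTestField.lean`
(the divergence-free test fields `ζ = −curl(φ curl (N ⋆ ξ))`). Kwon's localized Leray projection
`ℙ_φ = −curl(φ curl Δ⁻¹ ·)` (Def. 2.1) satisfies `ℙ_φ ∇p = 0` (Remark 2.3) and
`u = ℙ_φ u + h` on `B₁` for divergence-free `u`; the equation of the principal part
`v = ℙ_φ u = u − h` is obtained "rigorously by testing (NS) with `−curl(φ curl Δ⁻¹ξ)`"
(proof of Lemma 2.5, arXiv p. 8), i.e. through the DUALITY `⟨ℙ_φ u, ξ⟩ = ⟨u, ℙ_φ' ξ⟩`. This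
file proves that duality at a fixed time, entirely on the test side and without singular
integrals:

* **`Kwon2023.integral_inner_testField`**: for `u ∈ L¹(B₂)` weakly divergence free on `B₂`
  (`∫ ⟪u, ∇θ⟫ = 0` for every smooth `θ` supported in `B₂`) and `ξ ∈ C^∞` supported in
  `B̄(0, r)`, `r < 1`,
  `∫ ⟪u, ζ⟫ = ∫ ⟪u, ξ⟫ − ∫ ⟪h, ξ⟫`, `ζ = Kwon2023.testField ξ`, `h = Kwon2023.harmonicPart u`.

The proof follows the expansion `ζ = φ ξ − ∇(φ div A) + (div A) ∇φ − ∇φ × curl A`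
(`A = N ⋆ ξ`, `KwonTestField.testField_eq`): (A) pointwise
`⟪u, ζ⟫ = ⟪u, ξ⟫ − ⟪u, ∇(φ div A)⟫ + (div A)(u·∇φ) + ⟪∇φ × u, curl A⟫` (`inner_testField_eq`;
`φ ξ = ξ` as `φ = 1` on `supp ξ`); (B) the gradient term vanishes by the weak divergence-free
condition (`integral_inner_gradient_cutoff_mul_eq_zero`); (C) on the annulus carrying `∇φ`,
`div A = k ⋆ div ξ` for the smooth even annular kernel `k` (kernel swap of `KwonTestField`,
`divergence_convolution_lsmul`), so by Fubini (the adjoint of convolution with the even kernel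
`k`, `integral_smul_convolution_eq`) and one integration by parts
`∫ (div A)(u·∇φ) = ∫ (k ⋆ (u·∇φ)) div ξ = −∫ ⟪∇(k ⋆ (u·∇φ)), ξ⟫`
(`integral_divergence_mul_scalarDensity`); (D) likewise `curl A = curl (k ⋆ ξ)` there, written as
the absolutely convergent `∫ ∇k(x − y) × ξ(y) dy`
(`curl_convolution_lsmul_eq_integral_cross_of_locallyIntegrable`), and the triple product, Fubini
and the oddness of `∇k` (`gradient_annularKernel_neg`) give
`∫ ⟪∇φ × u, curl A⟫ = ∫ ⟪curl (k ⋆ (∇φ × u)), ξ⟫` (`integral_inner_vectorDensity_curl`);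
(E) summing, `∫ ⟪u, ζ⟩ = ∫ ⟪u, ξ⟫ − ∫ ⟪∇(k ⋆ (u·∇φ)) − curl(k ⋆ (∇φ × u)), ξ⟫ = ∫ ⟪u − h, ξ⟫`.

Deliberately NOT here (next files): the space–time version for a suitable weak solution on
`Q₂` (slicing the data, time-dependent `ξ`), the perturbed Navier–Stokes system and local energy
inequality satisfied by `v = u − h` (Lemma 2.5), Thm. 3.1 and the final assembly.

## Mathlib / tree search

Tree (reused): `Kwon2023.testField_eq`, `divergence_/curl_testPotential_eq`,
`contDiff_testPotential`, `tsupport_testField_subset` (`KwonTestField`); `Kwon2023.harmonicPart`,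
`annularKernel`, `contDiff_annularKernel`, `hasCompactSupport_annularKernel`,
`scalarDensity_eq_zero_of_lt/gt`, `vectorDensity_eq_zero_of_lt/gt`, `integrable_scalarDensity`,
`integrable_vectorDensity`, `contDiff_potential_scalar/vector` (`KwonHarmonicPart`);
`fderiv_convolution_lsmul_eq_integral`, `integrable_comp_sub_smul_fderiv`,
`convolution_lsmul_swap` (`HarmonicProbe` / `NewtonPotential` family),
`integral_fderiv_apply_eq_neg_integral_mul_divergence_of_hasCompactSupport`
(`DecayingScalarIntegrationByParts`), `integral_smul_convolution_eq` (`MollifiedField`),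
`inner_cross_right_eq_inner_cross_left`
(`DifferentiableGaussGreen`), `inner_cross_right_eq_neg_inner_cross_left`
(`DivFreeVectorPotential`), `norm_cross_le_mul_norm` (`LocalHelmholtzSupBound`), `crossCLM`,
`cross_swap`, `curlCLM_smulRight_innerSL`, `divergence_eq_traceCLM(_comp)` (`VectorCalculus*`,
`BiotSavartNewtonKernel`). Mathlib: `HasCompactSupport.hasFDerivAt_convolution_left`,
`ConvolutionExistsAt.integrable_swap`, `ContinuousLinearMap.integral_comp_comm`,
`MeasureTheory.integral_integral_swap`, `integral_inner`, `Integrable.mul_prod`.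
`lean search`: `curl_convolution_lsmul_eq_integral_cross` exists in `LambFormCurlKernel` for
CONTINUOUS fields only (here the density `∇φ × u` is merely `L¹`, whence the
`_of_locallyIntegrable` form); `integrable_inner_of_continuous_of_hasCompactSupport`
(`TypeIAncientMild`) and `hasCompactSupport_of_tsupport_subset` (`CommutatorRemainder`) are not
imported (heavy unrelated closures) — three-line copies
`integrable_inner_continuous_of_hasCompactSupport`,
`hasCompactSupport_of_tsupport_subset_closedBall` below.

## References

* H. Kwon, *The role of the pressure in the regularity theory for the Navier–Stokes
  equations*, J. Differential Equations (2023) = arXiv:2104.03160: Def. 2.1, Remark 2.3, proof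
  of Lemma 2.5 (arXiv p. 8). [Kwon2023RolePressure]
* D. Gilbarg, N. S. Trudinger, *Elliptic partial differential equations of second order* (2001),
  §2.4 and (2.16)–(2.17) (Green's representation, derivatives of Newtonian potentials).
  [GilbargTrudinger2001]
-/

noncomputable section

open MeasureTheory Set Function Filter Topology TopologicalSpace Metric InnerProductSpace
  ContinuousLinearMap
open scoped NNReal ENNReal RealInnerProductSpace Convolution Laplacian ContDiff

namespace Literature.Analysis.FluidPDE

namespace Kwon2023

/-! ### Generic convolution calculus for the duality identity -/

section Generic

variable {k : EuclideanSpace ℝ (Fin 3) → ℝ}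

/-- **`div (k ⋆ ξ) = k ⋆ div ξ`** for a `C¹_c` kernel and a `C¹` field (derivative on the field,
trace through the integral). [folklore] -/
theorem divergence_convolution_lsmul (hk : ContDiff ℝ 1 k) (hkc : HasCompactSupport k)
    {ξ : EuclideanSpace ℝ (Fin 3) → EuclideanSpace ℝ (Fin 3)} (hξ : ContDiff ℝ 1 ξ)
    (y : EuclideanSpace ℝ (Fin 3)) :
    VectorCalculus.divergence (k ⋆[lsmul ℝ ℝ, volume] ξ) y =
      (k ⋆ fun x => VectorCalculus.divergence ξ x) y := by
  rw [divergence_eq_traceCLM, fderiv_convolution_lsmul_eq_integral hk hkc hξ y,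
    ← traceCLM.integral_comp_comm (integrable_comp_sub_smul_fderiv hk hkc hξ y),
    convolution_lsmul_swap]
  refine integral_congr_ae (Eventually.of_forall fun x => ?_)
  simp only [map_smul, smul_eq_mul, divergence_eq_traceCLM]

/-- **`curl (k ⋆ w)(x) = ∫ ∇k(x − y) × w(y) dy`** for a `C¹_c` kernel and a locally integrable
field (derivative on the kernel, `curlCLM` through the integral, and
`curlCLM (Dk ⊗ w) = ∇k × w`). [folklore] -/
theorem curl_convolution_lsmul_eq_integral_cross_of_locallyIntegrable (hk : ContDiff ℝ 1 k) (hkc : HasCompactSupport k)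
    {w : EuclideanSpace ℝ (Fin 3) → EuclideanSpace ℝ (Fin 3)} (hw : LocallyIntegrable w volume)
    (x : EuclideanSpace ℝ (Fin 3)) :
    curl (k ⋆[lsmul ℝ ℝ, volume] w) x = ∫ y, cross (gradient k (x - y)) (w y) := by
  have hex : ConvolutionExistsAt (fderiv ℝ k) w x
      ((lsmul ℝ ℝ : ℝ →L[ℝ] EuclideanSpace ℝ (Fin 3) →L[ℝ] EuclideanSpace ℝ (Fin 3)).precompL
        (EuclideanSpace ℝ (Fin 3))) volume :=
    (hkc.fderiv (𝕜 := ℝ)).convolutionExists_left _ (hk.continuous_fderiv one_ne_zero) hw x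
  rw [curl_eq_curlCLM, (hkc.hasFDerivAt_convolution_left (lsmul ℝ ℝ) hk hw x).fderiv,
    convolution_eq_swap, ← curlCLM.integral_comp_comm hex.integrable_swap]
  refine integral_congr_ae (Eventually.of_forall fun y => ?_)
  have e : ((lsmul ℝ ℝ : ℝ →L[ℝ] EuclideanSpace ℝ (Fin 3) →L[ℝ] EuclideanSpace ℝ (Fin 3)).precompL
      (EuclideanSpace ℝ (Fin 3))) (fderiv ℝ k (x - y)) (w y) =
      (innerSL ℝ (gradient k (x - y))).smulRight (w y) := by
    ext a
    simp only [precompL_apply, lsmul_apply,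
      ContinuousLinearMap.smulRight_apply, innerSL_apply_apply, inner_gradient_left]
  show curlCLM (((lsmul ℝ ℝ : ℝ →L[ℝ] EuclideanSpace ℝ (Fin 3) →L[ℝ] EuclideanSpace ℝ (Fin 3)).precompL
      (EuclideanSpace ℝ (Fin 3))) (fderiv ℝ k (x - y)) (w y)) = cross (gradient k (x - y)) (w y)
  rw [e, curlCLM_smulRight_innerSL]

end Generic

/-! ### Evenness of the annular kernel and oddness of its gradient -/

/-- The annular kernel is even. [folklore] -/
theorem annularKernel_neg (z : EuclideanSpace ℝ (Fin 3)) : annularKernel (-z) = annularKernel z := by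
  simp only [annularKernel, newtonFar, radialCutoff, norm_neg, newtonKernel_eq, norm_neg]

/-- The gradient of the (even) annular kernel is odd. [folklore] -/
theorem gradient_annularKernel_neg (z : EuclideanSpace ℝ (Fin 3)) :
    gradient annularKernel (-z) = -gradient annularKernel z := by
  have hd : DifferentiableAt ℝ annularKernel (-z) :=
    (contDiff_annularKernel (n := 1)).differentiable one_ne_zero _
  set L : EuclideanSpace ℝ (Fin 3) →L[ℝ] EuclideanSpace ℝ (Fin 3) :=
    -ContinuousLinearMap.id ℝ (EuclideanSpace ℝ (Fin 3)) with hL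
  have hLd : HasFDerivAt (fun w : EuclideanSpace ℝ (Fin 3) => -w) L z :=
    (hasFDerivAt_id z).neg
  have h1 := (hd.hasFDerivAt.comp z hLd).fderiv
  have h2 : (annularKernel ∘ fun w : EuclideanSpace ℝ (Fin 3) => -w) = annularKernel :=
    funext annularKernel_neg
  rw [h2] at h1
  have h3 : ∀ a, fderiv ℝ annularKernel z a = -fderiv ℝ annularKernel (-z) a := fun a => by
    rw [h1]; simp [hL]
  apply ext_inner_right ℝ
  intro a
  rw [inner_neg_left, inner_gradient_left, inner_gradient_left, h3, neg_neg]

/-! ### Supports and integrability for the duality identity -/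

section Duality

variable {u ξ : EuclideanSpace ℝ (Fin 3) → EuclideanSpace ℝ (Fin 3)} {r : ℝ}

/-- A test field supported in `B̄(0, r)` has compact support. [folklore] -/
theorem hasCompactSupport_of_tsupport_subset_closedBall
    (hsupp : tsupport ξ ⊆ closedBall (0 : EuclideanSpace ℝ (Fin 3)) r) : HasCompactSupport ξ :=
  (isCompact_closedBall (0 : EuclideanSpace ℝ (Fin 3)) r).of_isClosed_subset isClosed_closure hsupp

/-- `φ ξ = ξ` for a test field supported in `B̄(0, r)`, `r < 1` (`φ = 1` on `|x| ≤ 5/4`). [folklore] -/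
theorem kwonCutoff_smul_eq (hr : r < 1)
    (hsupp : tsupport ξ ⊆ closedBall (0 : EuclideanSpace ℝ (Fin 3)) r) (x : EuclideanSpace ℝ (Fin 3)) :
    kwonCutoff x • ξ x = ξ x := by
  by_cases hx : x ∈ tsupport ξ
  · have h1 : ‖x‖ ≤ r := mem_closedBall_zero_iff.1 (hsupp hx)
    rw [kwonCutoff, radialCutoff_eq_one (by norm_num) (by norm_num) (by linarith), one_smul]
  · rw [image_eq_zero_of_notMem_tsupport hx, smul_zero]

/-- The vector potential of a compactly supported test field has compact support. [folklore] -/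
theorem hasCompactSupport_testPotential (hξc : HasCompactSupport ξ) :
    HasCompactSupport (testPotential ξ) :=
  (hasCompactSupport_newtonNear (by norm_num) (by norm_num)).convolution _ hξc

/-- `div A` is smooth. [folklore] -/
theorem contDiff_divergence_testPotential (hξ : ContDiff ℝ ∞ ξ) (hξc : HasCompactSupport ξ)
    {n : ℕ∞} : ContDiff ℝ n (VectorCalculus.divergence (testPotential ξ)) := by
  rw [divergence_eq_traceCLM_comp]
  exact traceCLM.contDiff.comp ((contDiff_testPotential hξ hξc (n := n + 1)).fderiv_right
    (m := n) le_rfl)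

/-- `div A` has compact support. [folklore] -/
theorem hasCompactSupport_divergence_testPotential (hξc : HasCompactSupport ξ) :
    HasCompactSupport (VectorCalculus.divergence (testPotential ξ)) := by
  rw [divergence_eq_traceCLM_comp]
  exact ((hasCompactSupport_testPotential hξc).fderiv (𝕜 := ℝ)).comp_left (map_zero _)

/-- `curl A` has compact support. [folklore] -/
theorem hasCompactSupport_curl_testPotential (hξc : HasCompactSupport ξ) :
    HasCompactSupport (curl (testPotential ξ)) :=
  hasCompactSupport_curl (hasCompactSupport_testPotential hξc)

/-- The scalar `φ · div A` is smooth with topological support in `B̄(0, 7/4) ⊆ B₂`. [folklore] -/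
theorem contDiff_kwonCutoff_mul_divergence (hξ : ContDiff ℝ ∞ ξ) (hξc : HasCompactSupport ξ)
    {n : ℕ∞} : ContDiff ℝ n fun y => kwonCutoff y * VectorCalculus.divergence (testPotential ξ) y :=
  contDiff_kwonCutoff.mul (contDiff_divergence_testPotential hξ hξc)

/-- `φ g` is supported in `B̄_{7/4}` for the Kwon cut-off `φ`. [folklore] -/
theorem tsupport_kwonCutoff_mul_subset (g : EuclideanSpace ℝ (Fin 3) → ℝ) :
    tsupport (fun y => kwonCutoff y * g y) ⊆ closedBall (0 : EuclideanSpace ℝ (Fin 3)) (7 / 4) :=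
  (tsupport_mul_subset_left (f := kwonCutoff) (g := g)).trans
    (tsupport_radialCutoff_subset (by norm_num) (by norm_num))

/-- **Pairing `u ∈ L¹(B₂)` with a bounded continuous field vanishing off `B₂` is integrable.**
[folklore] -/
theorem integrable_inner_of_eq_zero (hu : IntegrableOn u (ball (0 : EuclideanSpace ℝ (Fin 3)) 2))
    {g : EuclideanSpace ℝ (Fin 3) → EuclideanSpace ℝ (Fin 3)} (hg : Continuous g)
    (hg0 : ∀ x, 2 ≤ ‖x‖ → g x = 0) : Integrable fun x => ⟪u x, g x⟫ := by
  have hgc : HasCompactSupport g := by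
    refine HasCompactSupport.of_support_subset_isCompact (isCompact_closedBall 0 2) fun x hx => ?_
    rw [mem_closedBall_zero_iff]
    by_contra h
    exact hx (hg0 x (not_le.1 h).le)
  obtain ⟨C, hC⟩ := hg.bounded_above_of_compact_support hgc
  have heq : (fun x => ⟪u x, g x⟫) = (ball (0 : EuclideanSpace ℝ (Fin 3)) 2).indicator
      fun x => ⟪u x, g x⟫ := by
    funext x
    by_cases hx : x ∈ ball (0 : EuclideanSpace ℝ (Fin 3)) 2
    · rw [indicator_of_mem hx]
    · rw [indicator_of_notMem hx, hg0 x (not_lt.1 (mt mem_ball_zero_iff.2 hx)), inner_zero_right]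
  rw [heq, integrable_indicator_iff measurableSet_ball]
  refine Integrable.mono' (hu.norm.mul_const C) (hu.aestronglyMeasurable.inner hg.aestronglyMeasurable)
    (Eventually.of_forall fun x => ?_)
  rw [Real.norm_eq_abs]
  exact (abs_real_inner_le_norm _ _).trans (mul_le_mul_of_nonneg_left (hC x) (norm_nonneg _))

/-- Pairing an integrable density with a bounded continuous field is integrable. [folklore] -/
theorem integrable_inner_density {d g : EuclideanSpace ℝ (Fin 3) → EuclideanSpace ℝ (Fin 3)}
    (hd : Integrable d) (hg : Continuous g) (hgc : HasCompactSupport g) :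
    Integrable fun x => ⟪d x, g x⟫ := by
  obtain ⟨C, hC⟩ := hg.bounded_above_of_compact_support hgc
  refine Integrable.mono' (hd.norm.mul_const C) (hd.aestronglyMeasurable.inner hg.aestronglyMeasurable)
    (Eventually.of_forall fun x => ?_)
  rw [Real.norm_eq_abs]
  exact (abs_real_inner_le_norm _ _).trans (mul_le_mul_of_nonneg_left (hC x) (norm_nonneg _))

/-- Multiplying an integrable scalar density by a bounded continuous function is integrable.
[folklore] -/
theorem integrable_continuous_mul_of_hasCompactSupport {d g : EuclideanSpace ℝ (Fin 3) → ℝ}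
    (hd : Integrable d) (hg : Continuous g) (hgc : HasCompactSupport g) :
    Integrable fun x => g x * d x := by
  obtain ⟨C, hC⟩ := hg.bounded_above_of_compact_support hgc
  exact hd.bdd_mul hg.aestronglyMeasurable (Eventually.of_forall hC)

/-! ### Step A: the pointwise expansion of `⟪u, ζ⟫` -/

/-- **Pointwise**: `⟪u, ζ⟫ = ⟪u, ξ⟫ − ⟪u, ∇(φ div A)⟫ + (div A)(u·∇φ) + ⟪∇φ × u, curl A⟫`.
[cite: Kwon2023RolePressure, Lemma 2.5 (proof, p. 8)] -/
theorem inner_testField_eq (hξ : ContDiff ℝ ∞ ξ) (hr : r < 1)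
    (hsupp : tsupport ξ ⊆ closedBall (0 : EuclideanSpace ℝ (Fin 3)) r) (x : EuclideanSpace ℝ (Fin 3)) :
    ⟪u x, testField ξ x⟫ = ⟪u x, ξ x⟫
      - ⟪u x, gradient (fun y => kwonCutoff y * VectorCalculus.divergence (testPotential ξ) y) x⟫
      + VectorCalculus.divergence (testPotential ξ) x * scalarDensity u x
      + ⟪vectorDensity u x, curl (testPotential ξ) x⟫ := by
  have hξc := hasCompactSupport_of_tsupport_subset_closedBall hsupp
  have hsupp1 : tsupport ξ ⊆ ball (0 : EuclideanSpace ℝ (Fin 3)) 1 :=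
    hsupp.trans (closedBall_subset_ball hr)
  have hφd : DifferentiableAt ℝ kwonCutoff x :=
    (contDiff_kwonCutoff (n := 1)).differentiable one_ne_zero x
  have hgd : DifferentiableAt ℝ (VectorCalculus.divergence (testPotential ξ)) x :=
    (contDiff_divergence_testPotential hξ hξc (n := 1)).differentiable one_ne_zero x
  have hprod : gradient (fun y => kwonCutoff y * VectorCalculus.divergence (testPotential ξ) y) x =
      kwonCutoff x • gradient (VectorCalculus.divergence (testPotential ξ)) x +
        VectorCalculus.divergence (testPotential ξ) x • gradient kwonCutoff x := by
    simp only [gradient, fderiv_fun_mul hφd hgd, map_add, map_smul]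
  rw [testField_eq hξ hξc hsupp1 x, kwonCutoff_smul_eq hr hsupp x, hprod]
  simp only [inner_sub_right, inner_add_right, inner_smul_right, scalarDensity, vectorDensity,
    inner_cross_right_eq_neg_inner_cross_left]
  ring

/-! ### Step B: the gradient term is killed by the weak divergence-free condition -/

/-- **Step B**: `∫ ⟪u, ∇(φ div A)⟫ = 0` for `u` weakly divergence free on `B₂`. [folklore] -/
theorem integral_inner_gradient_cutoff_mul_eq_zero (hξ : ContDiff ℝ ∞ ξ)
    (hsupp : tsupport ξ ⊆ closedBall (0 : EuclideanSpace ℝ (Fin 3)) r)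
    (hdiv : ∀ θ : EuclideanSpace ℝ (Fin 3) → ℝ, ContDiff ℝ ∞ θ →
      tsupport θ ⊆ ball (0 : EuclideanSpace ℝ (Fin 3)) 2 → ∫ x, ⟪u x, gradient θ x⟫ = 0) :
    ∫ x, ⟪u x, gradient (fun y => kwonCutoff y * VectorCalculus.divergence (testPotential ξ) y) x⟫
      = 0 :=
  hdiv _ (contDiff_kwonCutoff_mul_divergence hξ (hasCompactSupport_of_tsupport_subset_closedBall hsupp))
    ((tsupport_kwonCutoff_mul_subset _).trans (closedBall_subset_ball (by norm_num)))

/-! ### Step C: the divergence term is the gradient part of `h` -/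

/-- The scalar density lives in the annulus `5/4 ≤ |x| ≤ 7/4`. [folklore] -/
theorem annulus_of_scalarDensity_ne_zero {x : EuclideanSpace ℝ (Fin 3)} (hx : scalarDensity u x ≠ 0) :
    5 / 4 ≤ ‖x‖ ∧ ‖x‖ ≤ 7 / 4 :=
  ⟨not_lt.1 fun h => hx (scalarDensity_eq_zero_of_lt h),
    not_lt.1 fun h => hx (scalarDensity_eq_zero_of_gt h)⟩

/-- The vector density lives in the annulus `5/4 ≤ |x| ≤ 7/4`. [folklore] -/
theorem annulus_of_vectorDensity_ne_zero {x : EuclideanSpace ℝ (Fin 3)} (hx : vectorDensity u x ≠ 0) :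
    5 / 4 ≤ ‖x‖ ∧ ‖x‖ ≤ 7 / 4 :=
  ⟨not_lt.1 fun h => hx (vectorDensity_eq_zero_of_lt h),
    not_lt.1 fun h => hx (vectorDensity_eq_zero_of_gt h)⟩

/-- The scalar density has compact support. [folklore] -/
theorem hasCompactSupport_scalarDensity : HasCompactSupport (scalarDensity u) :=
  HasCompactSupport.of_support_subset_isCompact (isCompact_closedBall 0 (7 / 4)) fun _ hx =>
    mem_closedBall_zero_iff.2 (annulus_of_scalarDensity_ne_zero hx).2

/-- The vector density has compact support. [folklore] -/
theorem hasCompactSupport_vectorDensity : HasCompactSupport (vectorDensity u) :=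
  HasCompactSupport.of_support_subset_isCompact (isCompact_closedBall 0 (7 / 4)) fun _ hx =>
    mem_closedBall_zero_iff.2 (annulus_of_vectorDensity_ne_zero hx).2

/-- **C1 (kernel swap against the scalar density)**:
`(div A)(u·∇φ) = (k ⋆ div ξ)(u·∇φ)` pointwise. [folklore] -/
theorem divergence_testPotential_mul_scalarDensity (hξ : ContDiff ℝ ∞ ξ) (hr : r < 1)
    (hsupp : tsupport ξ ⊆ closedBall (0 : EuclideanSpace ℝ (Fin 3)) r) (x : EuclideanSpace ℝ (Fin 3)) :
    VectorCalculus.divergence (testPotential ξ) x * scalarDensity u x =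
      (annularKernel ⋆ fun y => VectorCalculus.divergence ξ y) x * scalarDensity u x := by
  by_cases hx : scalarDensity u x = 0
  · rw [hx, mul_zero, mul_zero]
  · obtain ⟨h1, h2⟩ := annulus_of_scalarDensity_ne_zero hx
    rw [divergence_testPotential_eq hr hsupp h1 h2, divergence_convolution_lsmul
      (contDiff_annularKernel (n := 1)) hasCompactSupport_annularKernel (contDiff_infty.1 hξ 1) x]

/-- **Step C**: `∫ (div A)(u·∇φ) = −∫ ⟪∇(k ⋆ (u·∇φ)), ξ⟫` (kernel swap, the adjoint identity for
the even kernel `k`, and an integration by parts). [cite: Kwon2023RolePressure, Remark 2.3] -/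
theorem integral_divergence_mul_scalarDensity
    (hu : IntegrableOn u (ball (0 : EuclideanSpace ℝ (Fin 3)) 2)) (hξ : ContDiff ℝ ∞ ξ) (hr : r < 1)
    (hsupp : tsupport ξ ⊆ closedBall (0 : EuclideanSpace ℝ (Fin 3)) r) :
    ∫ x, VectorCalculus.divergence (testPotential ξ) x * scalarDensity u x =
      -∫ x, ⟪gradient (annularKernel ⋆ scalarDensity u) x, ξ x⟫ := by
  have hξc := hasCompactSupport_of_tsupport_subset_closedBall hsupp
  have hξ1 : ContDiff ℝ 1 ξ := contDiff_infty.1 hξ 1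
  have hd₁ := integrable_scalarDensity hu
  have hdivξ : Continuous fun y => VectorCalculus.divergence ξ y := by
    rw [show (fun y => VectorCalculus.divergence ξ y) = traceCLM ∘ fderiv ℝ ξ from
      divergence_eq_traceCLM_comp ξ]
    exact traceCLM.continuous.comp (hξ1.continuous_fderiv one_ne_zero)
  have hdivξc : HasCompactSupport fun y => VectorCalculus.divergence ξ y := by
    rw [show (fun y => VectorCalculus.divergence ξ y) = traceCLM ∘ fderiv ℝ ξ from
      divergence_eq_traceCLM_comp ξ]
    exact (hξc.fderiv (𝕜 := ℝ)).comp_left (map_zero _)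
  have e1 : (fun x => VectorCalculus.divergence (testPotential ξ) x * scalarDensity u x) =
      fun x => (annularKernel ⋆ fun y => VectorCalculus.divergence ξ y) x * scalarDensity u x :=
    funext (divergence_testPotential_mul_scalarDensity hξ hr hsupp)
  have e2 := integral_smul_convolution_eq (F := ℝ) (contDiff_annularKernel (n := 0)).continuous
    hasCompactSupport_annularKernel annularKernel_neg hdivξ hdivξc hd₁.locallyIntegrable
  have hF1 : ContDiff ℝ 1 (annularKernel ⋆ scalarDensity u) :=
    contDiff_potential_scalar hd₁.locallyIntegrable
  have hFc : HasCompactSupport (annularKernel ⋆ scalarDensity u) :=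
    hasCompactSupport_annularKernel.convolution _ hasCompactSupport_scalarDensity
  have e3 := integral_fderiv_apply_eq_neg_integral_mul_divergence_of_hasCompactSupport hξ1 hF1 hFc
  calc ∫ x, VectorCalculus.divergence (testPotential ξ) x * scalarDensity u x
      = ∫ x, (annularKernel ⋆ fun y => VectorCalculus.divergence ξ y) x * scalarDensity u x := by
        rw [e1]
    _ = ∫ x, VectorCalculus.divergence ξ x * (annularKernel ⋆ scalarDensity u) x := by
        simpa only [smul_eq_mul] using e2.symm
    _ = ∫ x, (annularKernel ⋆ scalarDensity u) x * VectorCalculus.divergence ξ x := by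
        congr 1; funext x; ring
    _ = -∫ x, fderiv ℝ (annularKernel ⋆ scalarDensity u) x (ξ x) := by rw [e3, neg_neg]
    _ = -∫ x, ⟪gradient (annularKernel ⋆ scalarDensity u) x, ξ x⟫ := by
        congr 1
        exact integral_congr_ae (Eventually.of_forall fun x => (inner_gradient_left _ _ _).symm)

/-! ### Step D: the curl term is the curl part of `h` -/

/-- The cross product of two continuous fields is continuous. [folklore] -/
theorem continuous_cross_of {X : Type*} [TopologicalSpace X]
    {f g : X → EuclideanSpace ℝ (Fin 3)} (hf : Continuous f) (hg : Continuous g) :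
    Continuous fun w => cross (f w) (g w) :=
  crossCLM.continuous₂.comp₂ hf hg

/-- The cross product is jointly continuous. [folklore] -/
theorem continuous_uncurry_cross : Continuous (uncurry cross) := by
  have : uncurry cross =
      fun p : EuclideanSpace ℝ (Fin 3) × EuclideanSpace ℝ (Fin 3) => crossCLM p.1 p.2 := by
    funext p; rw [uncurry_def, crossCLM_apply]
  rw [this]
  exact crossCLM.continuous₂

/-- A uniform bound for the gradient of the annular kernel. [folklore] -/
theorem exists_bound_gradient_annularKernel :
    ∃ K : ℝ, 0 ≤ K ∧ ∀ z, ‖gradient annularKernel z‖ ≤ K := by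
  have hc : Continuous (gradient annularKernel) :=
    FluidPDE.continuous_gradient_of_contDiff (contDiff_annularKernel (n := 1))
  have hcs : HasCompactSupport (gradient annularKernel) :=
    (hasCompactSupport_annularKernel.fderiv (𝕜 := ℝ)).comp_left (map_zero _)
  obtain ⟨K, hK⟩ := hc.bounded_above_of_compact_support hcs
  exact ⟨max K 0, le_max_right _ _, fun z => (hK z).trans (le_max_left _ _)⟩

/-- **D1 (kernel swap against the vector density)**: `⟪∇φ × u, curl A⟫ = ⟪∇φ × u, curl (k ⋆ ξ)⟫`
pointwise. [folklore] -/
theorem inner_vectorDensity_curl_testPotential (hr : r < 1)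
    (hsupp : tsupport ξ ⊆ closedBall (0 : EuclideanSpace ℝ (Fin 3)) r) (x : EuclideanSpace ℝ (Fin 3)) :
    ⟪vectorDensity u x, curl (testPotential ξ) x⟫ =
      ⟪vectorDensity u x, curl (annularKernel ⋆[lsmul ℝ ℝ, volume] ξ) x⟫ := by
  by_cases hx : vectorDensity u x = 0
  · rw [hx, inner_zero_left, inner_zero_left]
  · obtain ⟨h1, h2⟩ := annulus_of_vectorDensity_ne_zero hx
    rw [curl_testPotential_eq hr hsupp h1 h2]

/-- **Step D**: `∫ ⟪∇φ × u, curl A⟫ = ∫ ⟪curl (k ⋆ (∇φ × u)), ξ⟫` (kernel swap, `curl (k ⋆ ξ)` as the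
integral of `∇k(x − y) × ξ(y)`, triple product, Fubini, and oddness of `∇k`). [cite: Kwon2023RolePressure, Remark 2.3] -/
theorem integral_inner_vectorDensity_curl
    (hu : IntegrableOn u (ball (0 : EuclideanSpace ℝ (Fin 3)) 2)) (hξ : ContDiff ℝ ∞ ξ) (hr : r < 1)
    (hsupp : tsupport ξ ⊆ closedBall (0 : EuclideanSpace ℝ (Fin 3)) r) :
    ∫ x, ⟪vectorDensity u x, curl (testPotential ξ) x⟫ =
      ∫ y, ⟪curl (annularKernel ⋆[lsmul ℝ ℝ, volume] vectorDensity u) y, ξ y⟫ := by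
  have hξc := hasCompactSupport_of_tsupport_subset_closedBall hsupp
  have hξcont : Continuous ξ := hξ.continuous
  have hξint : Integrable ξ := hξcont.integrable_of_hasCompactSupport hξc
  have hd₂ := integrable_vectorDensity hu
  have hk1 : ContDiff ℝ 1 annularKernel := contDiff_annularKernel
  have hkc := hasCompactSupport_annularKernel
  have hgk : Continuous (gradient annularKernel) := FluidPDE.continuous_gradient_of_contDiff hk1
  obtain ⟨K, hK0, hK⟩ := exists_bound_gradient_annularKernel
  set G : EuclideanSpace ℝ (Fin 3) → EuclideanSpace ℝ (Fin 3) → ℝ :=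
    fun x y => ⟪cross (vectorDensity u x) (gradient annularKernel (x - y)), ξ y⟫ with hG
  -- (1) the left integrand as a `y`-integral
  have hiy : ∀ x, Integrable fun y => cross (gradient annularKernel (x - y)) (ξ y) := fun x => by
    have hc : Continuous fun y => cross (gradient annularKernel (x - y)) (ξ y) :=
      continuous_cross_of (hgk.comp (continuous_const.sub continuous_id)) hξcont
    refine hc.integrable_of_hasCompactSupport (hξc.mono fun y hy h0 => hy ?_)
    show cross (gradient annularKernel (x - y)) (ξ y) = 0
    rw [h0]; simp [cross]
  have h1 : ∀ x, ⟪vectorDensity u x, curl (testPotential ξ) x⟫ = ∫ y, G x y := fun x => by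
    rw [inner_vectorDensity_curl_testPotential hr hsupp x,
      curl_convolution_lsmul_eq_integral_cross_of_locallyIntegrable hk1 hkc hξcont.locallyIntegrable x,
      ← integral_inner (hiy x)]
    refine integral_congr_ae (Eventually.of_forall fun y => ?_)
    show ⟪vectorDensity u x, cross (gradient annularKernel (x - y)) (ξ y)⟫ = G x y
    rw [hG, inner_cross_right_eq_inner_cross_left]
  -- (2) Fubini
  have hGm : AEStronglyMeasurable (uncurry G) (volume.prod volume) := by
    have hA : AEStronglyMeasurable (fun p : EuclideanSpace ℝ (Fin 3) × EuclideanSpace ℝ (Fin 3) =>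
        vectorDensity u p.1) (volume.prod volume) := hd₂.aestronglyMeasurable.comp_fst
    have hB : Continuous fun p : EuclideanSpace ℝ (Fin 3) × EuclideanSpace ℝ (Fin 3) =>
        gradient annularKernel (p.1 - p.2) := hgk.comp (continuous_fst.sub continuous_snd)
    have hC : Continuous fun p : EuclideanSpace ℝ (Fin 3) × EuclideanSpace ℝ (Fin 3) => ξ p.2 :=
      hξcont.comp continuous_snd
    have hAB := continuous_uncurry_cross.comp_aestronglyMeasurable₂ hA hB.aestronglyMeasurable
    exact hAB.inner hC.aestronglyMeasurable
  have hint : Integrable (uncurry G) (volume.prod volume) := by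
    refine Integrable.mono' ((hd₂.norm.mul_const K).mul_prod hξint.norm) hGm
      (Eventually.of_forall fun p => ?_)
    rw [Real.norm_eq_abs]
    calc |uncurry G p| = |⟪cross (vectorDensity u p.1) (gradient annularKernel (p.1 - p.2)), ξ p.2⟫| :=
          rfl
      _ ≤ ‖cross (vectorDensity u p.1) (gradient annularKernel (p.1 - p.2))‖ * ‖ξ p.2‖ :=
          abs_real_inner_le_norm _ _
      _ ≤ ‖vectorDensity u p.1‖ * K * ‖ξ p.2‖ := by
          refine mul_le_mul_of_nonneg_right ?_ (norm_nonneg _)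
          exact (norm_cross_le_mul_norm _ _).trans (mul_le_mul_of_nonneg_left (hK _) (norm_nonneg _))
  have h2 : ∫ x, ∫ y, G x y = ∫ y, ∫ x, G x y := integral_integral_swap hint
  -- (3) the inner `x`-integral is the curl of the potential of the vector density
  have hix : ∀ y, Integrable fun x => cross (vectorDensity u x) (gradient annularKernel (x - y)) :=
    fun y => by
    have hm : AEStronglyMeasurable (fun x => cross (vectorDensity u x) (gradient annularKernel (x - y)))
        volume :=
      continuous_uncurry_cross.comp_aestronglyMeasurable₂ hd₂.aestronglyMeasurable
        (hgk.comp (continuous_id.sub continuous_const)).aestronglyMeasurable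
    refine Integrable.mono' (hd₂.norm.mul_const K) hm (Eventually.of_forall fun x => ?_)
    exact (norm_cross_le_mul_norm _ _).trans (mul_le_mul_of_nonneg_left (hK _) (norm_nonneg _))
  have h3 : ∀ y, ∫ x, G x y = ⟪curl (annularKernel ⋆[lsmul ℝ ℝ, volume] vectorDensity u) y, ξ y⟫ :=
    fun y => by
    have e : (fun x => G x y) = fun x =>
        ⟪ξ y, cross (vectorDensity u x) (gradient annularKernel (x - y))⟫ :=
      funext fun x => real_inner_comm _ _
    rw [e, integral_inner (hix y), real_inner_comm, curl_convolution_lsmul_eq_integral_cross_of_locallyIntegrable hk1 hkc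
      hd₂.locallyIntegrable y]
    have hneg : ∀ a b : EuclideanSpace ℝ (Fin 3), cross (-a) b = -cross a b := fun a b => by
      rw [← crossCLM_apply, ← crossCLM_apply, map_neg, _root_.neg_apply]
    congr 1
    refine integral_congr_ae (Eventually.of_forall fun x => ?_)
    show cross (vectorDensity u x) (gradient annularKernel (x - y)) =
      cross (gradient annularKernel (y - x)) (vectorDensity u x)
    rw [cross_swap, ← hneg, ← gradient_annularKernel_neg, neg_sub]
  calc ∫ x, ⟪vectorDensity u x, curl (testPotential ξ) x⟫ = ∫ x, ∫ y, G x y :=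
        integral_congr_ae (Eventually.of_forall h1)
    _ = ∫ y, ∫ x, G x y := h2
    _ = ∫ y, ⟪curl (annularKernel ⋆[lsmul ℝ ℝ, volume] vectorDensity u) y, ξ y⟫ :=
        integral_congr_ae (Eventually.of_forall h3)

/-! ### Step E: the slice duality identity -/

/-- Pairing a continuous field with a compactly supported continuous test field is integrable.
[folklore] -/
theorem integrable_inner_continuous_of_hasCompactSupport {F : EuclideanSpace ℝ (Fin 3) → EuclideanSpace ℝ (Fin 3)}
    (hF : Continuous F) (hξcont : Continuous ξ) (hξc : HasCompactSupport ξ) :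
    Integrable fun x => ⟪F x, ξ x⟫ :=
  (hF.inner hξcont).integrable_of_hasCompactSupport
    (hξc.mono fun x hx h0 => hx (show ⟪F x, ξ x⟫ = 0 by rw [h0, inner_zero_right]))

/-- **Kwon's slice duality identity** (Kwon 2023, Remark 2.3 with the proof of Lemma 2.5:
testing with `ζ = −curl(φ curl Δ⁻¹ξ)` sees the principal part `v = u − h`). For a velocity slice
`u ∈ L¹(B₂)` which is weakly divergence free on `B₂` (`∫ ⟪u, ∇θ⟫ = 0` for all smooth `θ`
supported in `B₂`) and a test field `ξ ∈ C^∞` supported in `B̄(0, r)`, `r < 1`: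
`∫ ⟪u, ζ⟫ = ∫ ⟪u, ξ⟫ − ∫ ⟪h, ξ⟫`, `h = Kwon2023.harmonicPart u`. [cite: Kwon2023RolePressure, Remark 2.3 and Lemma 2.5 (proof, p. 8)] -/
theorem integral_inner_testField
    (hu : IntegrableOn u (ball (0 : EuclideanSpace ℝ (Fin 3)) 2))
    (hdiv : ∀ θ : EuclideanSpace ℝ (Fin 3) → ℝ, ContDiff ℝ ∞ θ →
      tsupport θ ⊆ ball (0 : EuclideanSpace ℝ (Fin 3)) 2 → ∫ x, ⟪u x, gradient θ x⟫ = 0)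
    (hξ : ContDiff ℝ ∞ ξ) (hr : r < 1)
    (hsupp : tsupport ξ ⊆ closedBall (0 : EuclideanSpace ℝ (Fin 3)) r) :
    ∫ x, ⟪u x, testField ξ x⟫ = (∫ x, ⟪u x, ξ x⟫) - ∫ x, ⟪harmonicPart u x, ξ x⟫ := by
  have hξc := hasCompactSupport_of_tsupport_subset_closedBall hsupp
  have hξcont : Continuous ξ := hξ.continuous
  have hd₁ := integrable_scalarDensity hu
  have hd₂ := integrable_vectorDensity hu
  set A := testPotential ξ with hAdef
  set θ : EuclideanSpace ℝ (Fin 3) → ℝ := fun y => kwonCutoff y * VectorCalculus.divergence A y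
    with hθ
  -- Step A under the integral
  have eA : (fun x => ⟪u x, testField ξ x⟫) = fun x =>
      ⟪u x, ξ x⟫ - ⟪u x, gradient θ x⟫ + VectorCalculus.divergence A x * scalarDensity u x +
        ⟪vectorDensity u x, curl A x⟫ :=
    funext (inner_testField_eq hξ hr hsupp)
  -- integrability of the four terms
  have i1 : Integrable fun x => ⟪u x, ξ x⟫ := by
    refine integrable_inner_of_eq_zero hu hξcont fun x hx => image_eq_zero_of_notMem_tsupport ?_
    intro hmem
    have := mem_closedBall_zero_iff.1 (hsupp hmem)
    linarith
  have hθs : ContDiff ℝ ∞ θ := contDiff_kwonCutoff_mul_divergence hξ hξc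
  have i2 : Integrable fun x => ⟪u x, gradient θ x⟫ := by
    refine integrable_inner_of_eq_zero hu
      (FluidPDE.continuous_gradient_of_contDiff (contDiff_infty.1 hθs 1)) fun x hx => ?_
    have hx' : x ∉ tsupport θ := fun h => by
      have := mem_closedBall_zero_iff.1 (tsupport_kwonCutoff_mul_subset _ h)
      linarith
    rw [gradient, fderiv_of_notMem_tsupport ℝ hx', map_zero]
  have hdivA : Continuous fun y => VectorCalculus.divergence A y :=
    (contDiff_divergence_testPotential hξ hξc (n := 0)).continuous
  have hdivAc : HasCompactSupport fun y => VectorCalculus.divergence A y :=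
    hasCompactSupport_divergence_testPotential hξc
  have i3 : Integrable fun x => VectorCalculus.divergence A x * scalarDensity u x :=
    integrable_continuous_mul_of_hasCompactSupport hd₁ hdivA hdivAc
  have hcurlA : Continuous (curl A) := continuous_curl (contDiff_testPotential hξ hξc)
  have i4 : Integrable fun x => ⟪vectorDensity u x, curl A x⟫ :=
    integrable_inner_density hd₂ hcurlA (hasCompactSupport_curl_testPotential hξc)
  -- the two pieces of `∫ ⟪h, ξ⟫`
  have j1 : Integrable fun x => ⟪gradient (annularKernel ⋆ scalarDensity u) x, ξ x⟫ :=
    integrable_inner_continuous_of_hasCompactSupport (FluidPDE.continuous_gradient_of_contDiff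
      (contDiff_potential_scalar hd₁.locallyIntegrable)) hξcont hξc
  have j2 : Integrable fun x =>
      ⟪curl (annularKernel ⋆[lsmul ℝ ℝ, volume] vectorDensity u) x, ξ x⟫ :=
    integrable_inner_continuous_of_hasCompactSupport (continuous_curl (contDiff_potential_vector hd₂.locallyIntegrable))
      hξcont hξc
  have eh : ∫ x, ⟪harmonicPart u x, ξ x⟫ =
      (∫ x, ⟪gradient (annularKernel ⋆ scalarDensity u) x, ξ x⟫) -
        ∫ x, ⟪curl (annularKernel ⋆[lsmul ℝ ℝ, volume] vectorDensity u) x, ξ x⟫ := by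
    rw [← integral_sub j1 j2]
    refine integral_congr_ae (Eventually.of_forall fun x => ?_)
    show ⟪harmonicPart u x, ξ x⟫ = _
    rw [harmonicPart, inner_sub_left]
  have i12 : Integrable fun x => ⟪u x, ξ x⟫ - ⟪u x, gradient θ x⟫ := i1.sub i2
  have i123 : Integrable fun x => ⟪u x, ξ x⟫ - ⟪u x, gradient θ x⟫ +
      VectorCalculus.divergence A x * scalarDensity u x := i12.add i3
  rw [eA, integral_add i123 i4, integral_add i12 i3, integral_sub i1 i2,
    integral_inner_gradient_cutoff_mul_eq_zero hξ hsupp hdiv, sub_zero,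
    integral_divergence_mul_scalarDensity hu hξ hr hsupp,
    integral_inner_vectorDensity_curl hu hξ hr hsupp, eh]
  abel


/-- **The duality identity for a general (not necessarily divergence-free) field** `w ∈ L¹(B₂)`:
`∫ ⟪w, ζ_ξ⟫ = ∫ ⟪w, ξ⟫ − ∫ ⟪w, ∇(φ div A_ξ)⟫ − ∫ ⟪H w, ξ⟫` (`H w = Kwon2023.harmonicPart w`), i.e.
`ℙ_φ w = φ w − ∇Δ⁻¹(φ div w) − H w` read by duality (Kwon 2023, (llp1) and Remark 2.3, the identity
`g − ℙ_φ g = ∇Δ⁻¹(g·∇φ) − curl Δ⁻¹(∇φ × g)` on `Ω₀` holding for divergence-free `g` only). This is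
the form in which the convective term `Σⱼ ⟪uⱼ u, ζ_{∂ⱼξ}⟫` is treated (the fields `uⱼu` are not
divergence free; the middle term produces the pressure `q`).
[cite: Kwon2023RolePressure, Remark 2.3 and (llp1)] -/
theorem integral_inner_testField_eq_sub
    (hu : IntegrableOn u (ball (0 : EuclideanSpace ℝ (Fin 3)) 2))
    (hξ : ContDiff ℝ ∞ ξ) (hr : r < 1)
    (hsupp : tsupport ξ ⊆ closedBall (0 : EuclideanSpace ℝ (Fin 3)) r) :
    ∫ x, ⟪u x, testField ξ x⟫ =
      (∫ x, ⟪u x, ξ x⟫)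
        - (∫ x, ⟪u x, gradient (fun y => kwonCutoff y *
            VectorCalculus.divergence (testPotential ξ) y) x⟫)
        - ∫ x, ⟪harmonicPart u x, ξ x⟫ := by
  have hξc := hasCompactSupport_of_tsupport_subset_closedBall hsupp
  have hξcont : Continuous ξ := hξ.continuous
  have hd₁ := integrable_scalarDensity hu
  have hd₂ := integrable_vectorDensity hu
  set A := testPotential ξ with hAdef
  set θ : EuclideanSpace ℝ (Fin 3) → ℝ := fun y => kwonCutoff y * VectorCalculus.divergence A y
    with hθ
  -- Step A under the integral
  have eA : (fun x => ⟪u x, testField ξ x⟫) = fun x =>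
      ⟪u x, ξ x⟫ - ⟪u x, gradient θ x⟫ + VectorCalculus.divergence A x * scalarDensity u x +
        ⟪vectorDensity u x, curl A x⟫ :=
    funext (inner_testField_eq hξ hr hsupp)
  -- integrability of the four terms
  have i1 : Integrable fun x => ⟪u x, ξ x⟫ := by
    refine integrable_inner_of_eq_zero hu hξcont fun x hx => image_eq_zero_of_notMem_tsupport ?_
    intro hmem
    have := mem_closedBall_zero_iff.1 (hsupp hmem)
    linarith
  have hθs : ContDiff ℝ ∞ θ := contDiff_kwonCutoff_mul_divergence hξ hξc
  have i2 : Integrable fun x => ⟪u x, gradient θ x⟫ := by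
    refine integrable_inner_of_eq_zero hu
      (FluidPDE.continuous_gradient_of_contDiff (contDiff_infty.1 hθs 1)) fun x hx => ?_
    have hx' : x ∉ tsupport θ := fun h => by
      have := mem_closedBall_zero_iff.1 (tsupport_kwonCutoff_mul_subset _ h)
      linarith
    rw [gradient, fderiv_of_notMem_tsupport ℝ hx', map_zero]
  have hdivA : Continuous fun y => VectorCalculus.divergence A y :=
    (contDiff_divergence_testPotential hξ hξc (n := 0)).continuous
  have hdivAc : HasCompactSupport fun y => VectorCalculus.divergence A y :=
    hasCompactSupport_divergence_testPotential hξc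
  have i3 : Integrable fun x => VectorCalculus.divergence A x * scalarDensity u x :=
    integrable_continuous_mul_of_hasCompactSupport hd₁ hdivA hdivAc
  have hcurlA : Continuous (curl A) := continuous_curl (contDiff_testPotential hξ hξc)
  have i4 : Integrable fun x => ⟪vectorDensity u x, curl A x⟫ :=
    integrable_inner_density hd₂ hcurlA (hasCompactSupport_curl_testPotential hξc)
  -- the two pieces of `∫ ⟪h, ξ⟫`
  have j1 : Integrable fun x => ⟪gradient (annularKernel ⋆ scalarDensity u) x, ξ x⟫ :=
    integrable_inner_continuous_of_hasCompactSupport (FluidPDE.continuous_gradient_of_contDiff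
      (contDiff_potential_scalar hd₁.locallyIntegrable)) hξcont hξc
  have j2 : Integrable fun x =>
      ⟪curl (annularKernel ⋆[lsmul ℝ ℝ, volume] vectorDensity u) x, ξ x⟫ :=
    integrable_inner_continuous_of_hasCompactSupport (continuous_curl (contDiff_potential_vector hd₂.locallyIntegrable))
      hξcont hξc
  have eh : ∫ x, ⟪harmonicPart u x, ξ x⟫ =
      (∫ x, ⟪gradient (annularKernel ⋆ scalarDensity u) x, ξ x⟫) -
        ∫ x, ⟪curl (annularKernel ⋆[lsmul ℝ ℝ, volume] vectorDensity u) x, ξ x⟫ := by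
    rw [← integral_sub j1 j2]
    refine integral_congr_ae (Eventually.of_forall fun x => ?_)
    show ⟪harmonicPart u x, ξ x⟫ = _
    rw [harmonicPart, inner_sub_left]
  have i12 : Integrable fun x => ⟪u x, ξ x⟫ - ⟪u x, gradient θ x⟫ := i1.sub i2
  have i123 : Integrable fun x => ⟪u x, ξ x⟫ - ⟪u x, gradient θ x⟫ +
      VectorCalculus.divergence A x * scalarDensity u x := i12.add i3
  rw [eA, integral_add i123 i4, integral_add i12 i3, integral_sub i1 i2,
    integral_divergence_mul_scalarDensity hu hξ hr hsupp,
    integral_inner_vectorDensity_curl hu hξ hr hsupp, eh]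
  abel

end Duality

end Kwon2023

end Literature.Analysis.FluidPDE

end
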